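import Summits.ValiantsHypothesis.ValiantsHypothesis.Theses.FeketeSOS
import Summits.ValiantsHypothesis.ValiantsHypothesis.Theorems.FeketeNoSparseSplit.Negative.SmallModels

/-!
# `FeketeNoSparseSplit` (crux stmt-ValiantsHypothesis-3997): the hypotheses of the line's stubs are
load-bearing (and which are not); `C⁺` needs a PRIME modulus even cyclically

Negative-side facts for the line `Cruxes/FeketeNoSparseSplit/Lines/cyclic-valuation-dichotomy.lean`
(cdisprove cycle 2, refuter-cdisprove-stmt-ValiantsHypothesis-3997-g2-0), all PROVED, no new facts.
The four registered stubs are quoted by SIGNATURE (the skeleton is not imported); each theorem below negates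
the stub's exact signature with ONE hypothesis deleted, so "any proof of the stub must use that hypothesis".

* `stub_charPFewnomial` (`g ≠ 0 → deg g < p → (X-1)^m ∣ g → m+1 ≤ |supp g|` in characteristic `p`):
  - `stub_charPFewnomial_false_without_natDegree_lt` — drop `deg g < p`: FALSE, Frobenius witness
    `g = X^p - 1 = (X-1)^p` (two monomials, multiplicity `p`; at `p = 3` over `ZMod 3`).
  - `stub_charPFewnomial_false_without_charP` — drop `CharP K p` (keep `deg g < p`): FALSE, witness
    `K = ZMod 2`, `p = 3`, `g = X² - 1 = (X-1)²` (the degree bound must be against the characteristic OF `K`).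
  - `stub_charPFewnomial_false_without_ne_zero` — drop `g ≠ 0`: FALSE by convention (`g = 0`, `m = 0`).
  - `stub_charPFewnomial_tight` — the bound is ATTAINED for every `m < p` by `g = (X-1)^m` (`≤ m+1`
    monomials), so `m + 1` cannot be improved.
* `stub_feketeModPOrder` (`p ≠ 2 → ord₁ F̄_p = (p-1)/2`): `feketeModPOrder_at_two` — the hypothesis
  `p ≠ 2` is NOT load-bearing: `F_2 = X` and both sides are `0`, in every field.
* `stub_cyclicOrderDichotomy` (`A, B, F ≠ 0 → deg F < p → X^p-1 ∣ AB - cF → (c ≠ 0 → ord A + ord B = ord F)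
  ∧ (c = 0 → p ≤ ord A + ord B)`):
  - `stub_cyclicOrderDichotomy_false_without_F_ne_zero` — drop `F ≠ 0`: FALSE (`F = 0`, `c = 1`,
    `A = X^p - 1`, `B = 1`; Mathlib's `rootMultiplicity a 0 = 0`).
  - `stub_cyclicOrderDichotomy_false_without_natDegree_lt` — drop `deg F < p`: FALSE (`F = (X-1)^{p+1}`,
    `A = (X-1)^p`, `B = 1`, `c = 1`: `AB - F = (X^p - 1)(2 - X)` but `p + 0 ≠ p + 1`).  (All the proof uses is
    `ord₁ F < p`; `deg F < p` is the convenient sufficient form.)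
  - `stub_cyclicOrderDichotomy_false_without_A_ne_zero` — drop `A ≠ 0`: FALSE on the `c = 0` branch
    (`A = 0`, `B = F = 1`), again by the convention `ord(0) = 0`; on the `c ≠ 0` branch `A ≠ 0` is automatic.
* `stub_primitiveReduction`: its hypotheses `A ≠ 0`, `B ≠ 0` follow from `X^p - 1 ∣ AB - F_p` (degree), as
  the skeleton's composition already shows; nothing to drop.  Not refuted in any direction (it is a
  construction: valuation ring of `ℂ` above `p`, per-factor Gauss normalisation).
* `C⁺` WITHOUT PRIMALITY (the cyclic bound `(N+3)/2` for the Jacobi symbol modulo `N`, which for prime `N`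
  is verbatim the skeleton's `FeketeNoSparseCyclicSplit`): `not_jacobiNoSparseCyclicSplit` — FALSE at the
  squarefree `N = 15`, where the CRT splitting `(X¹⁰ - X⁵)·(X⁶ - X¹² - X³ + X⁹) ≡ F₁₅ (mod X¹⁵ - 1)`
  (`= F₃(X¹⁰)·F₅(X⁶)` with idempotent exponents `10 ≡ (1,0)`, `6 ≡ (0,1) mod (3,5)`) has support-sum
  `6 = ⌈2√8⌉`, the cyclic COUNTING bound (`jacobi_fifteen_cyclic_split`; the honest-polynomial minimum at
  `N = 15` is `8`, `jacobi_fifteen_split` in `SmallModels`); and `not_jacobiNoSparseSplit` — even the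
  POLYNOMIAL statement fails at the prime power `N = 9`: `F₉ = Σ_{3 ∤ m < 9} X^m = (X + X²)(1 + X³ + X⁶)`,
  support-sum `5 < 6` (`jacobi_nine_split`).  So the char-`p` lever needs `N` prime, not only odd (at
  `N = q²` the symbol is principal on units; at `N = qr` the cyclic algebra splits by CRT).
-/

namespace Summit.ValiantsHypothesis.Theorems.FeketeNoSparseSplit.Negative

open Polynomial Finset

section CharP

variable (K : Type*) [Field K] (p : ℕ) [Fact p.Prime] [CharP K p]

/-- Frobenius: `(X - 1)^p = X^p - 1` in `K[X]` when `char K = p`. [folklore] -/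
theorem X_sub_C_one_pow_char : (X - C (1 : K)) ^ p = X ^ p - 1 := by
  rw [sub_pow_char, ← C_pow, one_pow, C_1]

omit [CharP K p] in
/-- `X^p - 1` has exactly two monomials. [folklore] -/
theorem card_support_X_pow_sub_one : ((X : K[X]) ^ p - 1).support.card = 2 := by
  have hp : p ≠ 0 := (Fact.out : p.Prime).ne_zero
  have h : ((X : K[X]) ^ p - 1) = C 1 * X ^ p + C (-1) * X ^ 0 := by
    simp only [map_one, map_neg, one_mul, pow_zero, mul_one]
    ring
  rw [h, card_support_binomial hp one_ne_zero (neg_ne_zero.mpr one_ne_zero)]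

omit [CharP K p] in
/-- `X^p - 1 ≠ 0`. [folklore] -/
theorem X_pow_sub_one_ne_zero' : ((X : K[X]) ^ p - 1) ≠ 0 := by
  intro h
  have h2 := card_support_X_pow_sub_one K p
  rw [h, support_zero, Finset.card_empty] at h2
  exact absurd h2 (by norm_num)

omit [Fact p.Prime] [CharP K p] in
/-- **`stub_charPFewnomial` is tight**: for every `m < p` the polynomial `(X-1)^m` is non-zero, of degree
`m < p`, divisible by `(X-1)^m`, and has at most `m + 1` monomials — so the stub's `m + 1` cannot be
improved (given the stub, `(X-1)^m` has exactly `m+1` monomials in characteristic `p > m`). [folklore] -/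
theorem stub_charPFewnomial_tight (m : ℕ) (hm : m < p) :
    ∃ g : K[X], g ≠ 0 ∧ g.natDegree < p ∧ (X - C (1 : K)) ^ m ∣ g ∧ g.support.card ≤ m + 1 := by
  have hdeg : ((X - C (1 : K)) ^ m).natDegree = m := by
    rw [natDegree_pow, natDegree_X_sub_C, mul_one]
  refine ⟨(X - C 1) ^ m, pow_ne_zero _ (X_sub_C_ne_zero 1), by omega, dvd_rfl, ?_⟩
  calc ((X - C (1 : K)) ^ m).support.card ≤ ((X - C (1 : K)) ^ m).natDegree + 1 :=
        card_supp_le_succ_natDegree _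
    _ = m + 1 := by rw [hdeg]

end CharP

/-! ## Stub 1 `stub_charPFewnomial`: `deg g < p`, `CharP K p` and `g ≠ 0` are each load-bearing -/

/-- **`natDegree g < p` is load-bearing in `stub_charPFewnomial`**: without it the statement is false —
`g = X^p - 1 = (X - 1)^p` has multiplicity `p` at `1` but only two monomials (here `p = 3`, `K = ZMod 3`).
Multiplicity is no sparsity measure in degree `≥ p`. [folklore] -/
theorem stub_charPFewnomial_false_without_natDegree_lt :
    ¬ ∀ (K : Type) [Field K] (p : ℕ) [Fact p.Prime] [CharP K p] (g : K[X]) (m : ℕ),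
        g ≠ 0 → (X - C (1 : K)) ^ m ∣ g → m + 1 ≤ g.support.card := by
  intro H
  have h := H (ZMod 3) 3 ((X : (ZMod 3)[X]) ^ 3 - 1) 3 (X_pow_sub_one_ne_zero' (ZMod 3) 3)
    (by rw [X_sub_C_one_pow_char])
  rw [card_support_X_pow_sub_one] at h
  omega

/-- **`CharP K p` is load-bearing in `stub_charPFewnomial`** (the degree bound must be measured against the
characteristic of `K`): over `K = ZMod 2` with `p = 3`, `g = X² - 1 = (X-1)²` has degree `2 < 3`,
multiplicity `2`, and two monomials `< 3`. [folklore] -/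
theorem stub_charPFewnomial_false_without_charP :
    ¬ ∀ (K : Type) [Field K] (p : ℕ) [Fact p.Prime] (g : K[X]) (m : ℕ),
        g ≠ 0 → g.natDegree < p → (X - C (1 : K)) ^ m ∣ g → m + 1 ≤ g.support.card := by
  intro H
  have hdeg : ((X : (ZMod 2)[X]) ^ 2 - 1).natDegree < 3 := by
    rw [← C_1, natDegree_X_pow_sub_C]; norm_num
  have h := H (ZMod 2) 3 ((X : (ZMod 2)[X]) ^ 2 - 1) 2 (X_pow_sub_one_ne_zero' (ZMod 2) 2) hdeg
    (by rw [X_sub_C_one_pow_char])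
  rw [card_support_X_pow_sub_one] at h
  omega

/-- `g ≠ 0` is (trivially) load-bearing in `stub_charPFewnomial`: `g = 0` is divisible by everything and has
no monomials (`m = 0` already fails). [folklore] -/
theorem stub_charPFewnomial_false_without_ne_zero :
    ¬ ∀ (K : Type) [Field K] (p : ℕ) [Fact p.Prime] [CharP K p] (g : K[X]) (m : ℕ),
        g.natDegree < p → (X - C (1 : K)) ^ m ∣ g → m + 1 ≤ g.support.card := by
  intro H
  have h := H (ZMod 2) 2 0 0 (by simp) (dvd_zero _)
  simp at h

/-! ## Stub 2 `stub_feketeModPOrder`: `p ≠ 2` is NOT load-bearing -/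

/-- At `p = 2` the Fekete element is `F_2 = (0|2)·1 + (1|2)·X = X`, whose order at `1` is `0 = (2-1)/2` — in
EVERY field, no characteristic hypothesis needed.  So `stub_feketeModPOrder` also holds at `p = 2`; its
hypothesis `p ≠ 2` is cosmetic (kept by the planner to match the card). [folklore] -/
theorem feketeModPOrder_at_two (K : Type*) [Field K] :
    rootMultiplicity (1 : K) (∑ m ∈ Finset.range 2, C ((legendreSym 2 m : ℤ) : K) * X ^ m) = (2 - 1) / 2 := by
  have hF : (∑ m ∈ Finset.range 2, C ((legendreSym 2 m : ℤ) : K) * X ^ m) = X := by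
    simp [Finset.sum_range_succ, legendreSym.at_zero, legendreSym.at_one]
  have h2 : (2 - 1) / 2 = 0 := by norm_num
  rw [h2, hF]
  exact rootMultiplicity_eq_zero (by simp)

/-! ## Stub 3 `stub_cyclicOrderDichotomy`: `F ≠ 0`, `deg F < p`, `A ≠ 0` are each load-bearing -/

/-- **`F ≠ 0` is load-bearing in `stub_cyclicOrderDichotomy`**: with `F = 0`, `c = 1`, `A = X^p - 1`, `B = 1`
the divisibility holds but `ord₁ A + ord₁ B ≥ 1 > 0 = ord₁ 0` (Mathlib convention `rootMultiplicity a 0 = 0`;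
here `p = 3`). [folklore] -/
theorem stub_cyclicOrderDichotomy_false_without_F_ne_zero :
    ¬ ∀ (K : Type) [Field K] (p : ℕ) [Fact p.Prime] [CharP K p] (A B F : K[X]) (c : K),
      A ≠ 0 → B ≠ 0 → F.natDegree < p →
      (X ^ p - 1 : K[X]) ∣ A * B - C c * F →
        (c ≠ 0 → rootMultiplicity (1 : K) A + rootMultiplicity (1 : K) B = rootMultiplicity (1 : K) F) ∧
        (c = 0 → p ≤ rootMultiplicity (1 : K) A + rootMultiplicity (1 : K) B) := by
  intro H
  have hne := X_pow_sub_one_ne_zero' (ZMod 3) 3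
  have h := (H (ZMod 3) 3 (X ^ 3 - 1) 1 0 1 hne one_ne_zero (by simp) (by simp)).1 one_ne_zero
  have hpos : 0 < rootMultiplicity (1 : ZMod 3) ((X : (ZMod 3)[X]) ^ 3 - 1) := by
    rw [rootMultiplicity_pos hne]
    simp
  rw [rootMultiplicity_zero] at h
  omega

/-- **`natDegree F < p` is load-bearing in `stub_cyclicOrderDichotomy`**: with `F = (X-1)^{p+1}` (degree
`p + 1`), `A = (X-1)^p`, `B = 1`, `c = 1` we have `AB - F = (X-1)^p·(2 - X) = (X^p - 1)(2 - X)`, so the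
divisibility holds with `c ≠ 0`, but `ord₁ A + ord₁ B = p ≠ p + 1 = ord₁ F` (here `p = 3`).  What the proof
really uses is `ord₁ F < p`; `deg F < p` is its convenient sufficient form. [folklore] -/
theorem stub_cyclicOrderDichotomy_false_without_natDegree_lt :
    ¬ ∀ (K : Type) [Field K] (p : ℕ) [Fact p.Prime] [CharP K p] (A B F : K[X]) (c : K),
      A ≠ 0 → B ≠ 0 → F ≠ 0 →
      (X ^ p - 1 : K[X]) ∣ A * B - C c * F →
        (c ≠ 0 → rootMultiplicity (1 : K) A + rootMultiplicity (1 : K) B = rootMultiplicity (1 : K) F) ∧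
        (c = 0 → p ≤ rootMultiplicity (1 : K) A + rootMultiplicity (1 : K) B) := by
  intro H
  have hdiv : ((X : (ZMod 3)[X]) ^ 3 - 1) ∣ (X - C 1) ^ 3 * 1 - C 1 * (X - C 1) ^ 4 := by
    refine ⟨1 - (X - C 1), ?_⟩
    rw [← X_sub_C_one_pow_char (ZMod 3) 3, C_1]
    ring
  have h := (H (ZMod 3) 3 ((X - C 1) ^ 3) 1 ((X - C 1) ^ 4) 1 (pow_ne_zero _ (X_sub_C_ne_zero 1))
    one_ne_zero (pow_ne_zero _ (X_sub_C_ne_zero 1)) hdiv).1 one_ne_zero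
  rw [rootMultiplicity_X_sub_C_pow, rootMultiplicity_X_sub_C_pow, ← C_1, rootMultiplicity_C] at h
  omega

/-- `A ≠ 0` is (by convention) load-bearing in `stub_cyclicOrderDichotomy`, on the cancelling branch `c = 0`:
`A = 0`, `B = F = 1`, `c = 0` satisfy the divisibility (`0 - 0`), but `p ≤ ord₁ 0 + ord₁ 1 = 0` fails.  (On the
branch `c ≠ 0`, `A ≠ 0` follows from the other hypotheses.) [folklore] -/
theorem stub_cyclicOrderDichotomy_false_without_A_ne_zero :
    ¬ ∀ (K : Type) [Field K] (p : ℕ) [Fact p.Prime] [CharP K p] (A B F : K[X]) (c : K),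
      B ≠ 0 → F ≠ 0 → F.natDegree < p →
      (X ^ p - 1 : K[X]) ∣ A * B - C c * F →
        (c ≠ 0 → rootMultiplicity (1 : K) A + rootMultiplicity (1 : K) B = rootMultiplicity (1 : K) F) ∧
        (c = 0 → p ≤ rootMultiplicity (1 : K) A + rootMultiplicity (1 : K) B) := by
  intro H
  have h := (H (ZMod 3) 3 0 1 1 0 one_ne_zero one_ne_zero (by simp) (by simp)).2 rfl
  rw [rootMultiplicity_zero, ← C_1, rootMultiplicity_C] at h
  omega

/-! ## `C⁺` without primality: the Jacobi analogue fails cyclically at `N = 15` (at the counting bound)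
and polynomially at `N = 9` -/

/-- The second CRT factor at `N = 15`, `F₅(X⁶) mod (X¹⁵ - 1) = X⁶ - X¹² - X³ + X⁹`, in injective-exponent
form. [folklore] -/
theorem B15cyc_eq_sum : (X ^ 6 - X ^ 12 - X ^ 3 + X ^ 9 : ℂ[X]) =
    ∑ i : Fin 4, C ((![1, -1, -1, 1] : Fin 4 → ℂ) i) * X ^ ((![6, 12, 3, 9] : Fin 4 → ℕ) i) := by
  simp [Fin.sum_univ_succ]
  ring

/-- `X⁶ - X¹² - X³ + X⁹` has exactly four monomials. [folklore] -/
theorem card_support_B15cyc : ((X ^ 6 - X ^ 12 - X ^ 3 + X ^ 9 : ℂ[X])).support.card = 4 := by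
  rw [B15cyc_eq_sum]
  apply card_support_eq'
  · decide
  · intro i; fin_cases i <;> norm_num

/-- `deg (X⁶ - X¹² - X³ + X⁹) ≤ 12`. [folklore] -/
theorem natDegree_B15cyc_le : ((X ^ 6 - X ^ 12 - X ^ 3 + X ^ 9 : ℂ[X])).natDegree ≤ 12 := by
  rw [B15cyc_eq_sum]
  refine natDegree_sum_le_of_forall_le _ _ ?_
  intro i _
  refine (natDegree_C_mul_X_pow_le _ _).trans ?_
  fin_cases i <;> simp

/-- `X¹⁰ - X⁵` has two monomials. [folklore] -/
theorem card_support_X_pow_ten_sub_X_pow_five : ((X ^ 10 - X ^ 5 : ℂ[X])).support.card = 2 := by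
  have : (X ^ 10 - X ^ 5 : ℂ[X]) = C 1 * X ^ 10 + C (-1) * X ^ 5 := by simp; ring
  rw [this, card_support_binomial (by norm_num) (by norm_num) (by norm_num)]

/-- **CRT cyclic splitting at `N = 15`**: `(X¹⁰ - X⁵)·(X⁶ - X¹² - X³ + X⁹) ≡ F₁₅ (mod X¹⁵ - 1)` with both
degrees `< 15` and support-sum `2 + 4 = 6` — the cyclic counting bound `⌈2√8⌉` (`|supp F₁₅| = φ(15) = 8`),
far below `(15+3)/2 = 9`.  (`X¹⁰ - X⁵ = F₃(X¹⁰)` and `X⁶ - X¹² - X³ + X⁹ = F₅(X⁶)` reduced mod `X¹⁵ - 1`; the quotient is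
`X + X² + X⁴ - X⁷`.) [folklore] -/
theorem jacobi_fifteen_cyclic_split : ∃ A B : ℂ[X],
    A.natDegree < 15 ∧ B.natDegree < 15 ∧
    (X ^ 15 - 1 : ℂ[X]) ∣ A * B - ∑ m ∈ Finset.range 15, C ((jacobiSym m 15 : ℤ) : ℂ) * X ^ m ∧
    A.support.card + B.support.card = 6 := by
  refine ⟨X ^ 10 - X ^ 5, X ^ 6 - X ^ 12 - X ^ 3 + X ^ 9, ?_,
    lt_of_le_of_lt natDegree_B15cyc_le (by norm_num), ?_, ?_⟩
  · refine lt_of_le_of_lt (natDegree_sub_le _ _) ?_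
    rw [natDegree_X_pow, natDegree_X_pow]
    norm_num
  · rw [jacobiFekete_fifteen_eq]
    exact ⟨X + X ^ 2 + X ^ 4 - X ^ 7, by ring⟩
  · rw [card_support_X_pow_ten_sub_X_pow_five, card_support_B15cyc]

/-- **`C⁺` needs a PRIME modulus**: the cyclic bound `(N+3)/2` stated for the Jacobi symbol at all odd
`N ≥ 3` (for prime `N` this is verbatim the skeleton's `FeketeNoSparseCyclicSplit`, as `(m|p) = J(m|p)`) is
FALSE — at the squarefree `N = 15` by the CRT splitting of support-sum `6`. [folklore] -/
theorem not_jacobiNoSparseCyclicSplit :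
    ¬ ∀ (N : ℕ), Odd N → 3 ≤ N → ∀ A B : ℂ[X], A.natDegree < N → B.natDegree < N →
        (X ^ N - 1 : ℂ[X]) ∣ A * B - ∑ m ∈ Finset.range N, C ((jacobiSym m N : ℤ) : ℂ) * X ^ m →
        (N + 3) / 2 ≤ A.support.card + B.support.card := by
  intro H
  obtain ⟨A, B, hA, hB, hdiv, hcard⟩ := jacobi_fifteen_cyclic_split
  have h := H 15 (by decide) (by norm_num) A B hA hB hdiv
  omega

/-- The Jacobi–Fekete polynomial of `N = 9 = 3²`: the symbol is principal on units,
`F₉ = Σ_{3 ∤ m < 9} X^m`. [folklore] -/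
theorem jacobiFekete_nine_eq :
    (∑ m ∈ Finset.range 9, C ((jacobiSym m 9 : ℤ) : ℂ) * X ^ m) =
      X + X ^ 2 + X ^ 4 + X ^ 5 + X ^ 7 + X ^ 8 := by
  simp [Finset.sum_range_succ]
  norm_num

/-- `X + X²` has two monomials. [folklore] -/
theorem card_support_X_add_X_sq : ((X + X ^ 2 : ℂ[X])).support.card = 2 := by
  have : (X + X ^ 2 : ℂ[X]) = C 1 * X ^ 1 + C 1 * X ^ 2 := by simp
  rw [this, card_support_binomial (by norm_num) (by norm_num) (by norm_num)]

/-- `1 + X³ + X⁶` has three monomials. [folklore] -/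
theorem card_support_one_add_X_pow_three_add_X_pow_six :
    ((1 + X ^ 3 + X ^ 6 : ℂ[X])).support.card = 3 := by
  have : (1 + X ^ 3 + X ^ 6 : ℂ[X]) = C 1 * X ^ 0 + C 1 * X ^ 3 + C 1 * X ^ 6 := by simp
  rw [this, card_support_trinomial (by norm_num) (by norm_num) (by norm_num) (by norm_num) (by norm_num)]

/-- **Prime power**: `F₉ = (X + X²)·(1 + X³ + X⁶)` is an honest polynomial splitting of support-sum
`5 < 6 = (9+3)/2` (digit tiling of the units mod `9`). [folklore] -/
theorem jacobi_nine_split : ∃ A B : ℂ[X],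
    A * B = ∑ m ∈ Finset.range 9, C ((jacobiSym m 9 : ℤ) : ℂ) * X ^ m ∧
    A.support.card + B.support.card = 5 := by
  refine ⟨X + X ^ 2, 1 + X ^ 3 + X ^ 6, ?_, ?_⟩
  · rw [jacobiFekete_nine_eq]; ring
  · rw [card_support_X_add_X_sq, card_support_one_add_X_pow_three_add_X_pow_six]

/-- **Even the polynomial bound `(N+3)/2` needs `N` prime, not only odd**: FALSE at `N = 9` (support-sum
`5`; and at `N = 15` with `8`, `jacobi_fifteen_split`). [folklore] -/
theorem not_jacobiNoSparseSplit :
    ¬ ∀ (N : ℕ), Odd N → 3 ≤ N → ∀ A B : ℂ[X],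
        A * B = ∑ m ∈ Finset.range N, C ((jacobiSym m N : ℤ) : ℂ) * X ^ m →
        (N + 3) / 2 ≤ A.support.card + B.support.card := by
  intro H
  obtain ⟨A, B, hAB, hcard⟩ := jacobi_nine_split
  have h := H 9 (by decide) (by norm_num) A B hAB
  omega

end Summit.ValiantsHypothesis.Theorems.FeketeNoSparseSplit.Negative
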